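import Literature.NumberTheory.GelbartRogawski1991.LocalDoubledUnitarySmooth
import Literature.NumberTheory.GelbartRogawski1991.LocalDoubledUnitarySplitParabolic
import HarnessLib

-- buildfix G11b-3 recipe (LEDGER B13-1/B13-3): elaborate sequentially so the trailing `attribute [implicit_reducible]`
-- block (reducibilityCoreExt is keyed to the async environment branch) is in force at `.olean` export.
set_option Elab.async false

/-!
# Smoothness of the local Weil representation `ω = β⁻¹ · r ∘ ι` of the doubled unitary group at a SPLIT place

[cite: MoeglinVignerasWaldspurger1987, Chap. 2 II.8; Kudla1994, Thm 3.1; GelbartRogawski1991, §3.1 Prop. 3.1.1]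

At a place `v` of `F` that splits in `E` (`w ≠ c w` above `v`) the doubled unitary group is `H(F_v) ≅ GL_{n+n}(E_w)`
(projection to the `w`-component, tree `localPiSplitEquiv`), its Siegel parabolic `P_Δ` is the block-upper-triangular
group of the `Δ`-adapted frame, and the Iwahori factorisation of a congruence subgroup of `GL_{n+n}(E_w)`
(`exists_parabolic_mul_lower_of_mem_congruenceGL`) is already a factorisation INSIDE `H(F_v)`. Hence, exactly as at a
non-split place (`LocalDoubledUnitarySmooth`): if `r ∘ ι` is smooth along `P_Δ` (input L6a) and `β(p) = χ_w(det p_w)`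
on `P_Δ` with `χ_w` trivial near `1`, the genuine representation `ω = β⁻¹ · r ∘ ι` is smooth
(`smooth_of_parabolicSmooth_split`).

* §1 `P_Δ` is detected on the `w`-component alone at a split place (`isSiegelDelta_of_blkC_matW_eq_zero`: the
  `c⁻¹w`-component of `p` is tied to `p_w` by `(c_* p_{c⁻¹w})ᵀ J p_w = J`, whose `(1,1)` adapted block reads
  `C′ᵀ (2T₀) A = 0`);
* §2 the factorisation `k = p · (w_Δ u w_Δ⁻¹)` inside `H(F_v)` from the `GL` one;
* §3 smoothness.
-/

set_option autoImplicit false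

noncomputable section

open NumberField IsDedekindDomain Matrix Filter
open _root_.Topology
open Literature.NumberTheory.Automorphic Literature.NumberTheory.Automorphic.UnitaryGroup
open Literature.NumberTheory.GelbartRogawski1991.AdaptedBlocks
open Literature.RepresentationTheory.HeisenbergGroup

/-! ## §0 Two pieces of adapted-frame algebra -/

namespace Literature.NumberTheory.GelbartRogawski1991.AdaptedBlocks

variable {L : Type*} [CommRing L] {ι : Type*} [Fintype ι] [DecidableEq ι] [Invertible (2 : L)]

omit [Fintype ι] [DecidableEq ι] in
/-- a ring hom preserves `⅟2`. [cite: HarrisKudlaSweet1996, §1 (1.11)] -/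
theorem ringHom_map_invOf_two {L' : Type*} [CommRing L'] [Invertible (2 : L')] (f : L →+* L') : f (⅟(2 : L)) = ⅟(2 : L') := by
  have h : (2 : L') * f (⅟(2 : L)) = 1 := by
    rw [← map_ofNat f 2, ← _root_.map_mul, mul_invOf_self, map_one]
  exact (invOf_eq_right_inv h).symm

omit [Fintype ι] [Invertible (2 : L)] in
/-- `R` is preserved by ring homs. [cite: HarrisKudlaSweet1996, §1 (1.11)] -/
theorem cayR_map {L' : Type*} [CommRing L'] (f : L →+* L') : (cayR L ι).map f = cayR L' ι := by
  rw [cayR, Matrix.fromBlocks_map, Matrix.map_one f (map_zero f) (map_one f), Matrix.map_neg _ (map_neg f),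
    Matrix.map_one f (map_zero f) (map_one f), cayR]

omit [Fintype ι] in
/-- `R⁻¹` is preserved by ring homs. [cite: HarrisKudlaSweet1996, §1 (1.11)] -/
theorem cayRinv_map {L' : Type*} [CommRing L'] [Invertible (2 : L')] (f : L →+* L') :
    (cayRinv L ι).map f = cayRinv L' ι := by
  have : ((⅟(2 : L)) • cayR L ι).map f = f (⅟(2 : L)) • (cayR L ι).map f := by
    ext i j; simp only [Matrix.map_apply, Matrix.smul_apply, smul_eq_mul, _root_.map_mul]
  rw [cayRinv, this, cayR_map, ringHom_map_invOf_two, cayRinv]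

/-- **block-upper-triangularity passes through `Mᵀ (T ⊕ −T) N = T ⊕ −T`**: if `N` is invertible with `C(N) = 0`
then `C(M) = 0` (the `(1,1)` adapted block of the relation is `C(M)ᵀ (T+T) A(N) = 0`).
[cite: Kudla1994, §3; HarrisKudlaSweet1996, §1 (1.15)] -/
theorem blkC_eq_zero_of_transpose_mul {T : Matrix ι ι L} (hT : IsUnit T.det) {M N : Matrix (ι ⊕ ι) (ι ⊕ ι) L}
    (hMN : Mᵀ * Matrix.fromBlocks T 0 0 (-T) * N = Matrix.fromBlocks T 0 0 (-T)) (hN : blkC N = 0) (hNu : IsUnit N.det) :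
    blkC M = 0 := by
  have h := adapt_transpose_mul_antidiag_mul_adapt T hMN
  rw [adapt_eq M, adapt_eq N, hN, Matrix.fromBlocks_transpose, Matrix.fromBlocks_multiply, Matrix.fromBlocks_multiply] at h
  have h11 := (Matrix.fromBlocks_inj.1 h).1
  simp only [Matrix.mul_zero, zero_add, add_zero] at h11
  -- `h11 : (blkC M)ᵀ * (T + T) * blkA N = 0`
  have hτ : IsUnit (T + T).det := by
    rw [← two_smul L T, Matrix.det_smul]
    exact ((isUnit_of_invertible (2 : L)).pow _).mul hT
  have hA : IsUnit (blkA N).det := by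
    have e2 : (adapt N).det = N.det := by
      rw [adapt, Matrix.det_mul, Matrix.det_mul, mul_comm (cayRinv _ _).det, mul_assoc, ← Matrix.det_mul, cayRinv_mul_cayR,
        Matrix.det_one, mul_one]
    rw [adapt_eq, hN, Matrix.det_fromBlocks_zero₂₁] at e2
    exact isUnit_of_mul_isUnit_left (e2 ▸ hNu)
  have h1 : (blkC M)ᵀ * (T + T) = 0 := by
    calc (blkC M)ᵀ * (T + T) = (blkC M)ᵀ * (T + T) * blkA N * (blkA N)⁻¹ := (Matrix.mul_nonsing_inv_cancel_right _ _ hA).symm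
      _ = 0 := by rw [h11, Matrix.zero_mul]
  have h2 : (blkC M)ᵀ = 0 := by
    calc (blkC M)ᵀ = (blkC M)ᵀ * (T + T) * (T + T)⁻¹ := (Matrix.mul_nonsing_inv_cancel_right _ _ hτ).symm
      _ = 0 := by rw [h1, Matrix.zero_mul]
  simpa using congrArg Matrix.transpose h2

omit [Fintype ι] in
/-- `C(M)` is the `(2,1)` block of `adapt M`. [cite: Kudla1994, §3] -/
theorem blkC_eq_adapt_toBlocks₂₁ [Fintype ι] (M : Matrix (ι ⊕ ι) (ι ⊕ ι) L) : blkC M = (adapt M).toBlocks₂₁ := by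
  rw [adapt_eq, Matrix.toBlocks_fromBlocks₂₁]

omit [Fintype ι] [DecidableEq ι] [Invertible (2 : L)] in
/-- the group identity behind `k = p · (w u w⁻¹)` for `k = R p' u' R⁻¹`, `w = R s R⁻¹`, `s² = 1`. [cite: Kudla1994, §3] -/
theorem conj_factorisation_identity {G : Type*} [Group G] (R S x y : G) (hS : S * S = 1) :
    R * (x * y) * R⁻¹ = R * x * R⁻¹ * (R * S * R⁻¹ * (R * S * y * (R * S)⁻¹) * (R * S * R⁻¹)⁻¹) := by
  have h1 : R * x * R⁻¹ * (R * S * R⁻¹ * (R * S * y * (R * S)⁻¹) * (R * S * R⁻¹)⁻¹) =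
      R * x * (S * S) * y * (S * S)⁻¹ * R⁻¹ := by group
  rw [h1, hS, inv_one, mul_one, mul_one]; group

end Literature.NumberTheory.GelbartRogawski1991.AdaptedBlocks

namespace Literature.NumberTheory.GelbartRogawski1991.UnitaryDualPair.LocalSplitting

variable (F : Type) [Field F] [NumberField F] (E : Type) [Field E] [NumberField E] [Algebra F E]
  [Algebra.IsQuadraticExtension F E] (c : E ≃ₐ[F] E)
  {δ : E} (hcδ : c δ = -δ) (hδ : δ ≠ 0) {d : F} (hd : δ * δ = algebraMap F E d)
  (v : HeightOneSpectrum (𝓞 F)) (n : ℕ) {T₀ : Matrix (Fin n) (Fin n) F} (hT₀ : T₀.IsSymm) (hT₀d : IsUnit T₀.det)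
  {JD : Matrix (Fin (n + n)) (Fin (n + n)) E} (hJD : JD = (gramD F n T₀).map (algebraMap F E))

/-! ## §1 `H(F_v) ≅ GL_{n+n}(E_w)` at a split place; `P_Δ` from the `w`-component -/

omit [NumberField F] [NumberField E] [Algebra.IsQuadraticExtension F E] in
include hT₀ hJD in
/-- `J^𝔻` is hermitian (indeed real symmetric): `(c J^𝔻)ᵀ = J^𝔻`. [cite: HarrisKudlaSweet1996, §1 (1.9)] -/
theorem hermD_conj_transpose : (JD.map c)ᵀ = JD := by
  rw [hJD]
  ext i j
  simp only [Matrix.transpose_apply, Matrix.map_apply, AlgEquiv.commutes]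
  rw [(gramD_isSymm F n hT₀).apply i j]

omit [NumberField F] [Algebra.IsQuadraticExtension F E] in
include hT₀d hJD in
/-- `J^𝔻` is invertible at `w`. [cite: HarrisKudlaSweet1996, §1 (1.9)] -/
theorem isUnit_placeFormD (w : PlacesOver E v) : IsUnit (placeForm JD w.1) := by
  refine isUnit_placeForm JD ((Matrix.isUnit_iff_isUnit_det _).2 ?_) w.1
  rw [hJD, ← RingHom.mapMatrix_apply, ← RingHom.map_det]
  exact (isUnit_det_gramD F n hT₀d).map _

include hcδ hδ hT₀ hT₀d hJD in
/-- **`H(F_v) ≃ₜ* GL_{n+n}(E_w)` at a split place** (projection to the `w`-component). [cite: GelbartRogawski1991, §3.1 p. 456] -/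
def splitEquivD (w : PlacesOver E v) (hw : c • w.1 ≠ w.1) :
    UnitaryGroup.localPi E c (n + n) JD v ≃ₜ* GL (Fin (n + n)) (w.1.adicCompletion E) :=
  localPiSplitEquiv c JD (galConj_ne_one_of_delta F E c hcδ hδ) (hermD_conj_transpose F E c n hT₀ hJD) w hw
    (isUnit_placeFormD F E v n hT₀d hJD w)

include hcδ hδ hT₀ hT₀d hJD in
/-- `splitEquivD k = k_w`. [cite: GelbartRogawski1991, §3.1 p. 456] -/
@[simp] theorem splitEquivD_apply (w : PlacesOver E v) (hw : c • w.1 ≠ w.1) (k : UnitaryGroup.localPi E c (n + n) JD v) :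
    splitEquivD F E c hcδ hδ v n hT₀ hT₀d hJD w hw k = (k : UnitaryGroup.LocalGLPi E (n + n) v) w := rfl

include hcδ hδ hT₀ hT₀d hJD in
/-- the `w`-component of `splitEquivD.symm g` is `g`. [cite: GelbartRogawski1991, §3.1 p. 456] -/
theorem splitEquivD_symm_apply_w (w : PlacesOver E v) (hw : c • w.1 ≠ w.1) (g : GL (Fin (n + n)) (w.1.adicCompletion E)) :
    (((splitEquivD F E c hcδ hδ v n hT₀ hT₀d hJD w hw).symm g : UnitaryGroup.localPi E c (n + n) JD v) :
      UnitaryGroup.LocalGLPi E (n + n) v) w = g := by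
  rw [← splitEquivD_apply F E c hcδ hδ v n hT₀ hT₀d hJD w hw, ContinuousMulEquiv.apply_symm_apply]

omit [Algebra.IsQuadraticExtension F E] in
/-- the determinant of the `w`-component in adapted coordinates. [cite: Kudla1994, §3] -/
theorem isUnit_det_matW (w : PlacesOver E v) (p : UnitaryGroup.localPi E c (n + n) JD v) :
    IsUnit (matW F E c v n w p).det := by
  rw [matW, Matrix.reindex_apply, Equiv.symm_symm, Matrix.det_submatrix_equiv_self]
  exact (Matrix.isUnit_iff_isUnit_det _).1 (Units.isUnit _)

include hcδ hδ hd hT₀ hT₀d hJD in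
/-- **at a split place `P_Δ` is detected on the `w`-component**: `C(p_w) = 0 → p ∈ P_Δ`.
[cite: Kudla1994, §3; GelbartRogawski1991, §3.1 p. 456] -/
theorem isSiegelDelta_of_blkC_matW_eq_zero (w : PlacesOver E v) (hw : c • w.1 ≠ w.1)
    {p : UnitaryGroup.localPi E c (n + n) JD v} (hp : blkC (matW F E c v n w p) = 0) :
    IsSiegelDelta F E c hcδ hδ hd v n hT₀ hJD p := by
  have hc : c ≠ 1 := galConj_ne_one_of_delta F E c hcδ hδ
  rw [isSiegelDelta_iff_blocks]
  intro w'
  rcases PlacesOver.eq_or_eq_galInv c hc w w' with rfl | rfl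
  · exact (blkC_eq_zero_iff _).1 hp
  · -- the `c⁻¹w`-component, through `c_*`
    have hM : blkC ((matW F E c v n (PlacesOver.galInv c w) p).map (galAdicCompletionMap c (smul_inv_smul c w.1))) = 0 :=
      blkC_eq_zero_of_transpose_mul (isUnit_det_gramW F E v n hT₀d w) (transpose_conj_mul_form_mul F E c v n hJD p w) hp
        (isUnit_det_matW F E c v n w p)
    have h := (blkC_eq_zero_iff _).1 hM
    have e : ∀ X Y : Matrix (Fin n) (Fin n) ((PlacesOver.galInv c w).1.adicCompletion E),
        X.map (galAdicCompletionMap c (smul_inv_smul c w.1)) + Y.map (galAdicCompletionMap c (smul_inv_smul c w.1)) =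
          (X + Y).map (galAdicCompletionMap c (smul_inv_smul c w.1)) := fun X Y => (Matrix.map_add _ (map_add _) X Y).symm
    have e11 : ((matW F E c v n (PlacesOver.galInv c w) p).map (galAdicCompletionMap c (smul_inv_smul c w.1))).toBlocks₁₁ =
        (matW F E c v n (PlacesOver.galInv c w) p).toBlocks₁₁.map (galAdicCompletionMap c (smul_inv_smul c w.1)) := rfl
    have e12 : ((matW F E c v n (PlacesOver.galInv c w) p).map (galAdicCompletionMap c (smul_inv_smul c w.1))).toBlocks₁₂ =
        (matW F E c v n (PlacesOver.galInv c w) p).toBlocks₁₂.map (galAdicCompletionMap c (smul_inv_smul c w.1)) := rfl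
    have e21 : ((matW F E c v n (PlacesOver.galInv c w) p).map (galAdicCompletionMap c (smul_inv_smul c w.1))).toBlocks₂₁ =
        (matW F E c v n (PlacesOver.galInv c w) p).toBlocks₂₁.map (galAdicCompletionMap c (smul_inv_smul c w.1)) := rfl
    have e22 : ((matW F E c v n (PlacesOver.galInv c w) p).map (galAdicCompletionMap c (smul_inv_smul c w.1))).toBlocks₂₂ =
        (matW F E c v n (PlacesOver.galInv c w) p).toBlocks₂₂.map (galAdicCompletionMap c (smul_inv_smul c w.1)) := rfl
    rw [e11, e12, e21, e22, e, e] at h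
    exact Matrix.map_injective (galAdicCompletionMap c (smul_inv_smul c w.1)).injective h

/-! ## §2 The factorisation inside `H(F_v)` at a split place -/

omit [Algebra.IsQuadraticExtension F E] in
/-- the `w`-component of `R`: `R_w = reindex R` over `E_w`. [cite: HarrisKudlaSweet1996, §1 (1.11)] -/
theorem coe_toGLw_cayGL (w : PlacesOver E v) :
    ((toGLw F E v n w (cayGL F E v n) : GL (Fin (n + n)) (w.1.adicCompletion E)) : Matrix (Fin (n + n)) (Fin (n + n)) (w.1.adicCompletion E)) =
      Matrix.reindex (e₂ n) (e₂ n) (cayR (w.1.adicCompletion E) (Fin n)) := by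
  change (Matrix.reindex (e₂ n) (e₂ n) (cayR (LocalRing E v) (Fin n))).map _ = _
  rw [Matrix.reindex_apply, Matrix.reindex_apply, ← Matrix.submatrix_map, cayR_map]

omit [Algebra.IsQuadraticExtension F E] in
/-- the `w`-component of `R⁻¹`. [cite: HarrisKudlaSweet1996, §1 (1.11)] -/
theorem coe_toGLw_cayGL_inv (w : PlacesOver E v) :
    (((toGLw F E v n w (cayGL F E v n))⁻¹ : GL (Fin (n + n)) (w.1.adicCompletion E)) : Matrix (Fin (n + n)) (Fin (n + n)) (w.1.adicCompletion E)) =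
      Matrix.reindex (e₂ n) (e₂ n) (cayRinv (w.1.adicCompletion E) (Fin n)) := by
  change (Matrix.reindex (e₂ n) (e₂ n) (cayRinv (LocalRing E v) (Fin n))).map _ = _
  rw [Matrix.reindex_apply, Matrix.reindex_apply, ← Matrix.submatrix_map, cayRinv_map]

omit [NumberField F] [Algebra.IsQuadraticExtension F E] in
/-- the `w`-component of `s`. [cite: Kudla1994, §3] -/
theorem coe_toGLw_weylGL (w : PlacesOver E v) :
    ((toGLw F E v n w (weylGL F E v n) : GL (Fin (n + n)) (w.1.adicCompletion E)) : Matrix (Fin (n + n)) (Fin (n + n)) (w.1.adicCompletion E)) =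
      Matrix.reindex (e₂ n) (e₂ n) (Matrix.fromBlocks (0 : Matrix (Fin n) (Fin n) (w.1.adicCompletion E)) 1 1 0) := by
  change (Matrix.reindex (e₂ n) (e₂ n) (Matrix.fromBlocks (0 : Matrix (Fin n) (Fin n) (LocalRing E v)) 1 1 0)).map _ = _
  rw [Matrix.reindex_apply, Matrix.reindex_apply, ← Matrix.submatrix_map, Matrix.fromBlocks_map,
    Matrix.map_zero _ (map_zero _), Matrix.map_one _ (map_zero _) (map_one _)]

omit [NumberField F] [Algebra.IsQuadraticExtension F E] in
/-- `s_w² = 1`. [cite: Kudla1994, §3] -/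
theorem toGLw_weylGL_mul_self (w : PlacesOver E v) :
    toGLw F E v n w (weylGL F E v n) * toGLw F E v n w (weylGL F E v n) = 1 := by
  rw [← _root_.map_mul]
  have : weylGL F E v n * weylGL F E v n = 1 := Units.ext (by
    change Matrix.reindex (e₂ n) (e₂ n) _ * Matrix.reindex (e₂ n) (e₂ n) _ = 1
    rw [Matrix.reindex_apply, Matrix.submatrix_mul_equiv, weylAd_mul_weylAd, Matrix.submatrix_one_equiv])
  rw [this, map_one]

omit [Algebra.IsQuadraticExtension F E] in
/-- re-enumeration (inverse direction) is multiplicative. [cite: Kudla1994, §3] -/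
private theorem reindex_symm_mul {K : Type*} [CommRing K] (M N : Matrix (Fin (n + n)) (Fin (n + n)) K) :
    Matrix.reindex (e₂ n).symm (e₂ n).symm (M * N) =
      Matrix.reindex (e₂ n).symm (e₂ n).symm M * Matrix.reindex (e₂ n).symm (e₂ n).symm N := by
  rw [Matrix.reindex_apply, Matrix.reindex_apply, Matrix.reindex_apply, Matrix.submatrix_mul_equiv]

omit [Algebra.IsQuadraticExtension F E] in
/-- `reindex⁻¹ ∘ reindex = id`. [cite: Kudla1994, §3] -/
private theorem reindex_symm_reindex {K : Type*} (M : Matrix (Fin n ⊕ Fin n) (Fin n ⊕ Fin n) K) :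
    Matrix.reindex (e₂ n).symm (e₂ n).symm (Matrix.reindex (e₂ n) (e₂ n) M) = M := by
  rw [Matrix.reindex_apply, Matrix.reindex_apply, Matrix.submatrix_submatrix, Equiv.symm_symm, Equiv.symm_comp_self,
    Matrix.submatrix_id_id]

include hcδ hδ hT₀ hT₀d hJD in
/-- **the Weyl element `w_Δ ∈ H(F_v)` at a split place**: `w`-component `R s R⁻¹`. [cite: Kudla1994, §3] -/
def weylSplit (w : PlacesOver E v) (hw : c • w.1 ≠ w.1) : UnitaryGroup.localPi E c (n + n) JD v :=
  (splitEquivD F E c hcδ hδ v n hT₀ hT₀d hJD w hw).symm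
    (toGLw F E v n w (cayGL F E v n) * toGLw F E v n w (weylGL F E v n) * (toGLw F E v n w (cayGL F E v n))⁻¹)

include hcδ hδ hd hT₀ hT₀d hJD in
/-- **THE IWAHORI FACTORISATION INSIDE `H(F_v)` AT A SPLIT PLACE**: if `R⁻¹ k_w R ∈ K_γ` (`γ < 1`), then
`k = p · (w_Δ u w_Δ⁻¹)` with `p, u ∈ P_Δ(F_v)`, `p_w = R p' R⁻¹`, `u_w = (R s) u' (R s)⁻¹`, `p', u' ∈ K_γ`.
[cite: MoeglinVignerasWaldspurger1987, Chap. 2 II.8; BernsteinZelevinsky1976, §3.13] -/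
theorem exists_factorisation_split (w : PlacesOver E v) (hw : c • w.1 ≠ w.1)
    {γ : ValuativeRel.ValueGroupWithZero (w.1.adicCompletion E)} (hγ : γ < 1)
    (k : UnitaryGroup.localPi E c (n + n) JD v) (hk : adComp F E c v n w k ∈ congruenceGL (n + n) γ) :
    ∃ p u : UnitaryGroup.localPi E c (n + n) JD v,
      k = p * (weylSplit F E c hcδ hδ v n hT₀ hT₀d hJD w hw * u * (weylSplit F E c hcδ hδ v n hT₀ hT₀d hJD w hw)⁻¹) ∧
      IsSiegelDelta F E c hcδ hδ hd v n hT₀ hJD p ∧ IsSiegelDelta F E c hcδ hδ hd v n hT₀ hJD u ∧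
      (∃ p' ∈ congruenceGL (n + n) γ,
        (p : UnitaryGroup.LocalGLPi E (n + n) v) w = toGLw F E v n w (cayGL F E v n) * p' * (toGLw F E v n w (cayGL F E v n))⁻¹) ∧
      (∃ u' ∈ congruenceGL (n + n) γ,
        (u : UnitaryGroup.LocalGLPi E (n + n) v) w =
          toGLw F E v n w (cayGL F E v n) * toGLw F E v n w (weylGL F E v n) * u' *
            (toGLw F E v n w (cayGL F E v n) * toGLw F E v n w (weylGL F E v n))⁻¹) := by
  classical
  obtain ⟨p', hp'P, hp'K, u', hu'U, hu'K, hfac⟩ := exists_parabolic_mul_lower_of_mem_congruenceGL (lab n) hγ hk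
  set e := splitEquivD F E c hcδ hδ v n hT₀ hT₀d hJD w hw with he
  set R := toGLw F E v n w (cayGL F E v n) with hR
  set S := toGLw F E v n w (weylGL F E v n) with hS
  have hSS : S * S = 1 := toGLw_weylGL_mul_self F E v n w
  refine ⟨e.symm (R * p' * R⁻¹), e.symm (R * S * u' * (R * S)⁻¹), ?_, ?_, ?_,
    ⟨p', hp'K, splitEquivD_symm_apply_w F E c hcδ hδ v n hT₀ hT₀d hJD w hw _⟩,
    ⟨u', hu'K, splitEquivD_symm_apply_w F E c hcδ hδ v n hT₀ hT₀d hJD w hw _⟩⟩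
  · -- the identity in `H(F_v) ≅ GL_{n+n}(E_w)`
    apply e.injective
    have hk' : e k = R * (p' * u') * R⁻¹ := by
      rw [← hfac, he, splitEquivD_apply, adComp, ← hR]; group
    simp only [_root_.map_mul, map_inv, weylSplit, ← he, ContinuousMulEquiv.apply_symm_apply, hk']
    exact conj_factorisation_identity R S p' u' hSS
  · -- `p ∈ P_Δ`
    refine isSiegelDelta_of_blkC_matW_eq_zero F E c hcδ hδ hd v n hT₀ hT₀d hJD w hw ?_
    rw [matW, splitEquivD_symm_apply_w, Units.val_mul, Units.val_mul, coe_toGLw_cayGL, coe_toGLw_cayGL_inv, reindex_symm_mul,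
      reindex_symm_mul, reindex_symm_reindex, reindex_symm_reindex, blkC_eq_adapt_toBlocks₂₁, adapt_conj]
    exact toBlocks₂₁_eq_zero_of_blockTriangular n hp'P
  · -- `u ∈ P_Δ`
    refine isSiegelDelta_of_blkC_matW_eq_zero F E c hcδ hδ hd v n hT₀ hT₀d hJD w hw ?_
    have hSi : ((S⁻¹ : GL (Fin (n + n)) (w.1.adicCompletion E)) : Matrix (Fin (n + n)) (Fin (n + n)) (w.1.adicCompletion E)) =
        (S : Matrix (Fin (n + n)) (Fin (n + n)) (w.1.adicCompletion E)) := by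
      rw [inv_eq_of_mul_eq_one_right hSS]
    rw [matW, splitEquivD_symm_apply_w, _root_.mul_inv_rev, Units.val_mul, Units.val_mul, Units.val_mul, Units.val_mul, hSi,
      coe_toGLw_cayGL, coe_toGLw_cayGL_inv, coe_toGLw_weylGL]
    simp only [reindex_symm_mul, reindex_symm_reindex, Matrix.mul_assoc]
    rw [reindex_eq_fromBlocks_of_mem_unipotentRadicalGL n hu'U,
      ← Matrix.mul_assoc (Matrix.fromBlocks (0 : Matrix (Fin n) (Fin n) (w.1.adicCompletion E)) 1 1 0) (Matrix.fromBlocks 1 0 _ 1),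
      ← Matrix.mul_assoc (Matrix.fromBlocks (0 : Matrix (Fin n) (Fin n) (w.1.adicCompletion E)) 1 1 0 * Matrix.fromBlocks 1 0 _ 1),
      weylAd_mul_lowerUnip_mul_weylAd, ← Matrix.mul_assoc, blkC_eq_adapt_toBlocks₂₁, adapt_conj, Matrix.toBlocks_fromBlocks₂₁]

/-! ## §3 Smoothness at a split place -/

omit [NumberField F] [Algebra.IsQuadraticExtension F E] in
/-- `χ_w(det g) = 1` for `g ∈ GL_{n+n}(E_w)` close to `1`, if `χ_w` is trivial near `1`.
[cite: GelbartRogawski1991, §3.1 (3.1.2); MoeglinVignerasWaldspurger1987, Chap. 2 II.8] -/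
theorem chi_det_eq_one_nhds (w : PlacesOver E v) (χw : (w.1.adicCompletion E)ˣ →* ℂˣ)
    (hχ1 : ∀ᶠ x in 𝓝 (1 : w.1.adicCompletion E), ∀ hx : IsUnit x, χw hx.unit = 1) :
    ∀ᶠ g in 𝓝 (1 : GL (Fin (n + n)) (w.1.adicCompletion E)), χw (Matrix.GeneralLinearGroup.det g) = 1 := by
  have ht : Tendsto (fun g : GL (Fin (n + n)) (w.1.adicCompletion E) =>
      (g : Matrix (Fin (n + n)) (Fin (n + n)) (w.1.adicCompletion E)).det) (𝓝 1) (𝓝 1) := by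
    have := (Units.continuous_val.matrix_det (R := w.1.adicCompletion E) (n := Fin (n + n))).tendsto
      (1 : GL (Fin (n + n)) (w.1.adicCompletion E))
    rwa [Units.val_one, Matrix.det_one] at this
  filter_upwards [ht.eventually hχ1] with g hg
  have hu : IsUnit ((g : Matrix (Fin (n + n)) (Fin (n + n)) (w.1.adicCompletion E)).det) :=
    (Matrix.isUnit_iff_isUnit_det _).1 (Units.isUnit g)
  have : Matrix.GeneralLinearGroup.det g = hu.unit := Units.ext (by rw [Matrix.GeneralLinearGroup.val_det_apply, IsUnit.unit_spec])
  rw [this]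
  exact hg hu

include hcδ hδ hd hT₀ hT₀d hJD in
/-- **SMOOTHNESS OF THE LOCAL WEIL REPRESENTATION OF `H(F_v)` AT A SPLIT PLACE** (L6s of the GR-1 skeleton, modulo
the parabolic smoothness L6a of the section): with `β` splitting the multiplier of `r ∘ ι` and
`β|_{P_Δ} = χ_w ∘ det ∘ pr_w` (`χ_w` trivial near `1`), every `Φ` is fixed by `β(k)⁻¹ r(ι k)` for `k` in an open
subgroup of `H(F_v)`. [cite: MoeglinVignerasWaldspurger1987, Chap. 2 II.8; Kudla1994, Thm 3.1; GelbartRogawski1991, §3.1 Prop. 3.1.1] -/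
theorem smooth_of_parabolicSmooth_split (w : PlacesOver E v) (hw : c • w.1 ≠ w.1)
    (χw : (w.1.adicCompletion E)ˣ →* ℂˣ)
    (hχ1 : ∀ᶠ x in 𝓝 (1 : w.1.adicCompletion E), ∀ hx : IsUnit x, χw hx.unit = 1)
    (hU : ImplementerUniqueUpToScalar (localSchrodinger F (n + n) (gramD F n T₀) v))
    (r : ImplementerSection (localSchrodinger F (n + n) (gramD F n T₀) v))
    (hL6a : ∀ Φ : SchwartzBruhat (Fin (n + n) → v.adicCompletion F),
      ∃ γ : ValuativeRel.ValueGroupWithZero (w.1.adicCompletion E), γ ≠ 0 ∧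
        ∀ p : UnitaryGroup.localPi E c (n + n) JD v, IsSiegelDelta F E c hcδ hδ hd v n hT₀ hJD p →
          ((p : UnitaryGroup.LocalGLPi E (n + n) v) w ∈ congruenceGL (n + n) γ) →
          r (iotaD F E c hcδ hδ hd v n hT₀ hJD p) Φ = Φ)
    (β : UnitaryGroup.localPi E c (n + n) JD v → ℂˣ)
    (hβ : ∀ g₁ g₂, β (g₁ * g₂) * r.cocycle hU (iotaD F E c hcδ hδ hd v n hT₀ hJD g₁) (iotaD F E c hcδ hδ hd v n hT₀ hJD g₂) =
      β g₁ * β g₂)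
    (hβP : ∀ p, IsSiegelDelta F E c hcδ hδ hd v n hT₀ hJD p →
      β p = χw (Matrix.GeneralLinearGroup.det ((p : UnitaryGroup.LocalGLPi E (n + n) v) w)))
    (Φ : SchwartzBruhat (Fin (n + n) → v.adicCompletion F)) :
    ∃ U : Subgroup (UnitaryGroup.localPi E c (n + n) JD v),
      IsOpen (U : Set (UnitaryGroup.localPi E c (n + n) JD v)) ∧
        ∀ k ∈ U, ((β k)⁻¹ : ℂˣ) • r (iotaD F E c hcδ hδ hd v n hT₀ hJD k) Φ = Φ := by
  classical
  set ι := iotaD F E c hcδ hδ hd v n hT₀ hJD with hι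
  set w₀ : UnitaryGroup.localPi E c (n + n) JD v := weylSplit F E c hcδ hδ v n hT₀ hT₀d hJD w hw with hw₀
  refine ⟨r.omegaStabilizer hU ι hβ Φ, r.isOpen_omegaStabilizer_of_mem_nhds hU ι hβ Φ ?_, fun k hk => hk⟩
  obtain ⟨γΦ, hγΦ, hΦ⟩ := hL6a Φ
  obtain ⟨γΨ, hγΨ, hΨ⟩ := hL6a (r.omega ι β w₀⁻¹ Φ)
  have hχ := chi_det_eq_one_nhds F E v n w χw hχ1
  have hTP : ((congruenceGL (n + n) γΦ : Set (GL (Fin (n + n)) (w.1.adicCompletion E))) ∩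
      {g | χw (Matrix.GeneralLinearGroup.det g) = 1}) ∈ 𝓝 1 :=
    inter_mem ((isOpen_congruenceGL hγΦ).mem_nhds (Subgroup.one_mem _)) hχ
  have hTN : ((congruenceGL (n + n) γΨ : Set (GL (Fin (n + n)) (w.1.adicCompletion E))) ∩
      {g | χw (Matrix.GeneralLinearGroup.det g) = 1}) ∈ 𝓝 1 :=
    inter_mem ((isOpen_congruenceGL hγΨ).mem_nhds (Subgroup.one_mem _)) hχ
  obtain ⟨γ₁, hγ₁⟩ := exists_congruenceGL_conj_subset F E v w (toGLw F E v n w (cayGL F E v n)) hTP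
  obtain ⟨γ₂, hγ₂⟩ := exists_congruenceGL_conj_subset F E v w (toGLw F E v n w (cayGL F E v n) * toGLw F E v n w (weylGL F E v n)) hTN
  obtain ⟨γ₃, hγ₃⟩ := exists_unit_lt_one F E v w
  set γ : ValuativeRel.ValueGroupWithZero (w.1.adicCompletion E) :=
    min (γ₁ : ValuativeRel.ValueGroupWithZero (w.1.adicCompletion E)) (min γ₂ γ₃) with hγdef
  have hγ0 : γ ≠ 0 := ne_of_gt (lt_min (zero_lt_iff.2 γ₁.ne_zero) (lt_min (zero_lt_iff.2 γ₂.ne_zero) (zero_lt_iff.2 γ₃.ne_zero)))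
  have hγlt : γ < 1 := lt_of_le_of_lt ((min_le_right _ _).trans (min_le_right _ _)) hγ₃
  have hγle₁ : congruenceGL (n + n) γ ≤ congruenceGL (n + n) (γ₁ : ValuativeRel.ValueGroupWithZero (w.1.adicCompletion E)) :=
    congruenceGL_mono (min_le_left _ _)
  have hγle₂ : congruenceGL (n + n) γ ≤ congruenceGL (n + n) (γ₂ : ValuativeRel.ValueGroupWithZero (w.1.adicCompletion E)) :=
    congruenceGL_mono ((min_le_right _ _).trans (min_le_left _ _))
  refine r.omegaStabilizer_mem_nhds_of_factorisation hU ι hβ Φ (adComp_mem_congruenceGL_mem_nhds F E c v n w hγ0) w₀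
    fun k hk => ?_
  obtain ⟨p, u, hfac, hpΔ, huΔ, ⟨p', hp', hpw⟩, ⟨u', hu', huw⟩⟩ :=
    exists_factorisation_split F E c hcδ hδ hd v n hT₀ hT₀d hJD w hw hγlt k hk
  have hp1 := hγ₁ p' (hγle₁ hp')
  have hu1 := hγ₂ u' (hγle₂ hu')
  rw [← hpw] at hp1
  rw [← huw] at hu1
  refine ⟨p, u, hfac, ?_, ?_⟩
  · rw [ImplementerSection.omega_apply, hβP p hpΔ, hp1.2, inv_one, one_smul]
    exact hΦ p hpΔ hp1.1
  · rw [ImplementerSection.omega_apply, hβP u huΔ, hu1.2, inv_one, one_smul]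
    exact hΨ u huΔ hu1.1

/-! ### Build-lane note (ops-buildfix G11b-3 recipe, LEDGER B13-1, 2026-08-21)
`lean -o` (the hub build lane, never `lean`/the gate check) runs Lean 4.32's library-suggestion indexers
(`Lean.LibrarySuggestions.SymbolFrequency` / `SineQuaNon`, from their `exportEntriesFn`) over the statement of
every local theorem that is not a denied premise; on this family's statements (very large dependent binder
telescopes through the theta-kernel / dual-pair data) that fold runs for tens of minutes to hours and the build
lane kills the job (incident G11b-3, run/shared/lean/ops/buildfix/G11b-3-DOSSIER.md). `isDeniedPremise` skips
`[implicit_reducible]` constants before any fold, and a reducibility status on a *theorem* is inert (Meta never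
unfolds `thmInfo`; the kernel ignores the attribute), so the public theorems of this file are tagged
`[implicit_reducible]` purely to keep them out of that index. Only other effect: they are not offered by
`+suggestions` premise selectors. No statement or proof is changed; superseded if the operator lands a
deny-list form (`HarnessLib.PremiseIndex`). -/
set_option allowUnsafeReducibility true in
attribute [implicit_reducible]
  _root_.Literature.NumberTheory.GelbartRogawski1991.AdaptedBlocks.ringHom_map_invOf_two
  _root_.Literature.NumberTheory.GelbartRogawski1991.AdaptedBlocks.cayR_map
  _root_.Literature.NumberTheory.GelbartRogawski1991.AdaptedBlocks.cayRinv_map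
  _root_.Literature.NumberTheory.GelbartRogawski1991.AdaptedBlocks.blkC_eq_zero_of_transpose_mul
  _root_.Literature.NumberTheory.GelbartRogawski1991.AdaptedBlocks.blkC_eq_adapt_toBlocks₂₁
  _root_.Literature.NumberTheory.GelbartRogawski1991.AdaptedBlocks.conj_factorisation_identity
  hermD_conj_transpose isUnit_placeFormD splitEquivD_apply splitEquivD_symm_apply_w isUnit_det_matW
  isSiegelDelta_of_blkC_matW_eq_zero coe_toGLw_cayGL coe_toGLw_cayGL_inv coe_toGLw_weylGL
  toGLw_weylGL_mul_self exists_factorisation_split chi_det_eq_one_nhds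
  smooth_of_parabolicSmooth_split

end Literature.NumberTheory.GelbartRogawski1991.UnitaryDualPair.LocalSplitting

end
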